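import Summits.Ventures.CertifiedArithmetic.LowPrec.GemmThetaLawE2M3FamilyWord
import Summits.Ventures.CertifiedArithmetic.LowPrec.GemmThetaLawGenMixAData
import Summits.Ventures.CertifiedArithmetic.LowPrec.GemmThetaLawGenSem
import HarnessLib

/-!
# GEMM worst case LIII-a — the canonical E2M3·E2M1 (FP6·FP4) family for EVERY precision
# `p ≥ 8`: the word, its trajectory and its mass (grid units `2^-4`)

HONEST FRAMING: certified error envelopes and provably optimal rounding/accumulation schemes for
low-precision formats under stated cost models; every table by two implementations; no hardware or
vendor claims.

The UPPER side of the mixed E2M3·E2M1 θ-law (gemm.tex Thm. `t:thetapmix`, first row)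
symbolically in the precision: the construction of files XLIX-a/b and LI-a/b
(`GemmThetaLawE2M1FamilyWord`/`Family`, `GemmThetaLawE2M3FamilyWord`/`Family`) transplanted
to the 165-letter alphabet `Λ(E2M3·E2M1)/2^4` of the generated law `e2m3e2m1Law`
(`GemmThetaLawGenMixAData`; grid `2^-4`, `J = 9`).  For a target format `φ` with
`p = manBits φ + 1 ≥ 8` write `K = 2^(p-8)` (`2^manBits = 128K`, `N = 2^(p-2) = 64K`).  In GRID
UNITS the family `fam4 K` is the word
  `256^{×K} | 3^{×N} | (3,2)^{×N} (5,4)^{×N} (9,8)^{×N} (18,16)^{×N} (33,32)^{×N} (66,64)^{×N}`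
  `(132,128)^{×N} (264,256)^{×N} | 528 | (-480)^∞`
(every letter a product of an E2M3 and an E2M1 datum, `fam4_mem`; at `p = 8`, `K = 1`, it is
the certified `bfloat16` family of Prop. `p:theta`(ii), `m = 1090`): the `K` letters `16 = 4·4`
are summed EXACTLY up to `256K = 2·2^manBits` (bottom of binade 0, spacing 2); each `3` is
`spacing + tie` from an even point, resolved up (`+4`); in binade `j = 1..8` (spacing `2^(j+1)`)
the pair `(x_j, 2^j)`, `2^j < x_j < 2^(j+1)`, advances the accumulator one grid step per letter
(`x_j` exceeds the half-spacing from an even point, `2^j` is a tie from an odd point resolved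
up) until `128K·1024 = 2^(p+9)`, where `528 > 512` rounds up to `v° = (128K+1)·1024`; every
later `-480` is absorbed (`v° - 480 = 128K·1024 + 544` rounds back up).  Prefix
`m_p = 1089K + 1` letters (`= 17·2^(p-2) + 2^(p-8) + 1`, the onset of Thm. `t:thetapmix`),
mass `L = 67008K + 528` (`sum_fam4Z`; value `1047·2^(p-6) + 33`), end deficit
`2L - v° = 2944K + 32 = 480·θ_p` grid units, `θ_p = (23·2^manBits + 32)/480` the constant of
the law (`e2m3e2m1Law.thetaL`).  File LIII-b (`GemmThetaLawMixAFamily`) proves the trajectory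
and the closed form of the relative error; file LIV (`GemmWorstCaseMixAPrec`) the sandwich
for `W_p(n)` over the mixed alphabet.
References: the law / SUP side for every `p ≥ 10` is `thetaCert_e2m3e2m1Law`
(`GemmThetaLawGenFinal`); worst cases of recursive summation are format-by-format in the
literature ([Higham2002, §4.2], [MullerEtAl2018HFPA, §6.1]; Flocq [BoldoMelquiond2011Flocq]);
FP6/FP4 values [RouhaniEtAl2023MX, Table 1].
-/

namespace Summit.Ventures.CertifiedArithmetic.LowPrec.Gemm

open Literature.ComputerArithmetic.FloatingPoint
open Literature.ComputerArithmetic.FloatingPoint.MiniFloat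
open Literature.ComputerArithmetic.FloatingPoint.MiniFloat.ThetaLaw (e2m3e2m1Law)
open Finset

variable {φ : Format}

/-- Range bookkeeping: `n < 2^(m+16)` and `2^(m+12) ≤ maxRat` give `n/16 ≤ maxRat`. [folklore] -/
theorem grid4_le_maxRat (hR : (2 : ℚ) ^ (φ.manBits + 12) ≤ φ.maxRat) {n : ℕ}
    (hn : n < 2 ^ (φ.manBits + 12 + 4)) : (n : ℚ) / 16 ≤ φ.maxRat := by
  have h := grid_le_maxRat_of_lt (G := 4) (E := 12) hR (K := (n : ℤ))
    (by rw [Int.natAbs_natCast]; exact hn)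
  rw [Int.natAbs_natCast] at h
  norm_num at h
  exact h

/-- THE GRID BRIDGE on natural numbers: `fl_φ(n/16) = rneSigMag m n / 16`. [folklore] -/
theorem roundNE_grid4_nat (hq : φ.qexp ≤ -4) (hR : (2 : ℚ) ^ (φ.manBits + 12) ≤ φ.maxRat)
    {n : ℕ} (hn : n < 2 ^ (φ.manBits + 12 + 4)) :
    (roundNE φ ((n : ℚ) / 16)).toRat = (rneSigMag φ.manBits n : ℚ) / 16 := by
  have hR' : (((n : ℤ).natAbs : ℕ) : ℚ) / 2 ^ 4 ≤ φ.maxRat := by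
    rw [Int.natAbs_natCast]; norm_num; exact grid4_le_maxRat hR hn
  have h := toRat_roundNE_grid_prec (G := 4) (by exact_mod_cast hq) (n : ℤ) hR'
  rw [rneZ_natCast, Int.cast_natCast, Int.cast_natCast] at h
  norm_num at h
  exact h

/-- ONE VALUE STEP from an integer step (grid `2^-4`): if `a + c = n`, `n` is in range and
`rneSigMag m n = b`, then `fl_φ(a/16 + c/16) = b/16` and `|a/16 + c/16| ≤ maxRat`. [folklore] -/
theorem value_step4 (hq : φ.qexp ≤ -4) (hR : (2 : ℚ) ^ (φ.manBits + 12) ≤ φ.maxRat)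
    {a n b : ℕ} {c : ℤ} (hK : (a : ℤ) + c = n) (hn : n < 2 ^ (φ.manBits + 12 + 4))
    (hround : rneSigMag φ.manBits n = b) :
    (roundNE φ ((a : ℚ) / 16 + (c : ℚ) / 16)).toRat = (b : ℚ) / 16 ∧
      |(a : ℚ) / 16 + (c : ℚ) / 16| ≤ φ.maxRat := by
  have e : (a : ℚ) / 16 + (c : ℚ) / 16 = ((n : ℕ) : ℚ) / 16 := by
    have hK' : (a : ℚ) + (c : ℚ) = (n : ℚ) := by exact_mod_cast hK
    rw [← hK']; ring
  have h0 : (0 : ℚ) ≤ ((n : ℕ) : ℚ) / 16 := div_nonneg (Nat.cast_nonneg n) (by norm_num)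
  refine ⟨by rw [e, roundNE_grid4_nat hq hR hn, hround], ?_⟩
  rw [e, abs_of_nonneg h0]
  exact grid4_le_maxRat hR hn

/-- The letters of blocks `5..8`, the end letter and the tail (grid units); split off `fam4Z`
to keep every `if`-chain short. [cell] -/
def fam4Zhi (K k : ℕ) : ℤ :=
  if k + 1 ≤ 705 * K then pairZ 33 32 (k - 577 * K)
  else if k + 1 ≤ 833 * K then pairZ 66 64 (k - 705 * K)
  else if k + 1 ≤ 961 * K then pairZ 132 128 (k - 833 * K)
  else if k + 1 ≤ 1089 * K then pairZ 264 256 (k - 961 * K)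
  else if k = 1089 * K then 528
  else -480

/-- The letters in grid units `2^-4` (see the module docstring).
[cell, gemm.tex Thm. t:thetapmix] -/
def fam4Z (K k : ℕ) : ℤ :=
  if k + 1 ≤ K then 256
  else if k + 1 ≤ 65 * K then 3
  else if k + 1 ≤ 193 * K then pairZ 3 2 (k - 65 * K)
  else if k + 1 ≤ 321 * K then pairZ 5 4 (k - 193 * K)
  else if k + 1 ≤ 449 * K then pairZ 9 8 (k - 321 * K)
  else if k + 1 ≤ 577 * K then pairZ 18 16 (k - 449 * K)
  else fam4Zhi K k

/-- The accumulator from binade 5 on (split off `traj4N` to keep every `if`-chain short):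
one grid step `2^(j+1)` per letter in binade `j = 5..8`, then `v° = (128K+1)·1024`. [cell] -/
def traj4Nhi (K k : ℕ) : ℕ :=
  if k + 1 ≤ 705 * K then 64 * (k + 1 + 128 * K - 577 * K)
  else if k + 1 ≤ 833 * K then 128 * (k + 1 + 128 * K - 705 * K)
  else if k + 1 ≤ 961 * K then 256 * (k + 1 + 128 * K - 833 * K)
  else if k + 1 ≤ 1089 * K then 512 * (k + 1 + 128 * K - 961 * K)
  else 131072 * K + 1024

/-- The accumulator after letter `k`, in grid units: `256(k+1)` on the exact prefix, `+4` per
letter `3` in binade 0, one grid step `2^(j+1)` per letter in binade `j = 1..4`, then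
`traj4Nhi`. [cell] -/
def traj4N (K k : ℕ) : ℕ :=
  if k + 1 ≤ K then 256 * (k + 1)
  else if k + 1 ≤ 65 * K then 252 * K + 4 * (k + 1)
  else if k + 1 ≤ 193 * K then 4 * (k + 1 + 128 * K - 65 * K)
  else if k + 1 ≤ 321 * K then 8 * (k + 1 + 128 * K - 193 * K)
  else if k + 1 ≤ 449 * K then 16 * (k + 1 + 128 * K - 321 * K)
  else if k + 1 ≤ 577 * K then 32 * (k + 1 + 128 * K - 449 * K)
  else traj4Nhi K k

/-- The family as rational data (values = grid units `/ 16`). [cell] -/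
def fam4 (K k : ℕ) : ℚ := (fam4Z K k : ℚ) / 16

/-- The trajectory as rational values. [cell] -/
def traj4 (K k : ℕ) : ℚ := (traj4N K k : ℚ) / 16

/-- Prefix block: the first `K` letters are `256` (value `16 = 4·4`). [cell] -/
theorem fam4Z_P {K k : ℕ} (h : k < K) : fam4Z K k = 256 := by
  rw [fam4Z, if_pos (by omega)]

/-- Binade 0: `64K` letters `3` (value `3/16 = 0.375·0.5`). [cell] -/
theorem fam4Z_B0 {K k : ℕ} (h1 : K ≤ k) (h2 : k < 65 * K) : fam4Z K k = 3 := by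
  unfold fam4Z; split_ifs <;> omega

/-- Binade 1: `(3,2)` alternating, offset form. [cell] -/
theorem fam4Z_B1 (K e : ℕ) (he : e < 128 * K) :
    fam4Z K (65 * K + e) = pairZ 3 2 e := by
  unfold fam4Z; split_ifs <;> first | omega | (congr 1; omega)

/-- Binade 2: `(5,4)` alternating, offset form. [cell] -/
theorem fam4Z_B2 (K e : ℕ) (he : e < 128 * K) :
    fam4Z K (193 * K + e) = pairZ 5 4 e := by
  unfold fam4Z; split_ifs <;> first | omega | (congr 1; omega)

/-- Binade 3: `(9,8)` alternating, offset form. [cell] -/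
theorem fam4Z_B3 (K e : ℕ) (he : e < 128 * K) :
    fam4Z K (321 * K + e) = pairZ 9 8 e := by
  unfold fam4Z; split_ifs <;> first | omega | (congr 1; omega)

/-- Binade 4: `(18,16)` alternating, offset form. [cell] -/
theorem fam4Z_B4 (K e : ℕ) (he : e < 128 * K) :
    fam4Z K (449 * K + e) = pairZ 18 16 e := by
  unfold fam4Z; split_ifs <;> first | omega | (congr 1; omega)

/-- From binade 5 on the letters are read off `fam4Zhi`. [cell] -/
theorem fam4Z_hi {K k : ℕ} (h : 577 * K ≤ k) : fam4Z K k = fam4Zhi K k := by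
  unfold fam4Z; split_ifs <;> omega

/-- Binade 5: `(33,32)` alternating, offset form. [cell] -/
theorem fam4Z_B5 (K e : ℕ) (he : e < 128 * K) :
    fam4Z K (577 * K + e) = pairZ 33 32 e := by
  rw [fam4Z_hi (by omega)]; unfold fam4Zhi; split_ifs <;> first | omega | (congr 1; omega)

/-- Binade 6: `(66,64)` alternating, offset form. [cell] -/
theorem fam4Z_B6 (K e : ℕ) (he : e < 128 * K) :
    fam4Z K (705 * K + e) = pairZ 66 64 e := by
  rw [fam4Z_hi (by omega)]; unfold fam4Zhi; split_ifs <;> first | omega | (congr 1; omega)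

/-- Binade 7: `(132,128)` alternating, offset form. [cell] -/
theorem fam4Z_B7 (K e : ℕ) (he : e < 128 * K) :
    fam4Z K (833 * K + e) = pairZ 132 128 e := by
  rw [fam4Z_hi (by omega)]; unfold fam4Zhi; split_ifs <;> first | omega | (congr 1; omega)

/-- Binade 8: `(264,256)` alternating, offset form. [cell] -/
theorem fam4Z_B8 (K e : ℕ) (he : e < 128 * K) :
    fam4Z K (961 * K + e) = pairZ 264 256 e := by
  rw [fam4Z_hi (by omega)]; unfold fam4Zhi; split_ifs <;> first | omega | (congr 1; omega)

/-- The end letter `528` (value `33 = 5.5·6`) reaching `v°`. [cell] -/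
theorem fam4Z_E (K : ℕ) : fam4Z K (1089 * K) = 528 := by
  rw [fam4Z_hi (by omega)]; unfold fam4Zhi; split_ifs <;> omega

/-- The absorbed tail: every later letter is `-480` (value `-30 = -7.5·4`). [cell] -/
theorem fam4Z_tail {K k : ℕ} (h : 1089 * K < k) : fam4Z K k = -480 := by
  rw [fam4Z_hi (by omega)]; unfold fam4Zhi; split_ifs <;> omega

/-- Trajectory on the prefix block: exact sums `256(k+1)`. [cell] -/
theorem traj4N_P {K k : ℕ} (h : k + 1 ≤ K) : traj4N K k = 256 * (k + 1) := by
  unfold traj4N; rw [if_pos h]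

/-- Trajectory through binade 0: `+4` per letter from `256K`. [cell] -/
theorem traj4N_B0 {K k : ℕ} (h1 : K ≤ k + 1) (h2 : k + 1 ≤ 65 * K) :
    traj4N K k = 252 * K + 4 * (k + 1) := by
  unfold traj4N; split_ifs <;> omega

/-- Trajectory through binade 1: spacing `4` (grid units). [cell] -/
theorem traj4N_T1 {K k : ℕ} (h1 : 65 * K ≤ k + 1) (h2 : k + 1 ≤ 193 * K) :
    traj4N K k = 4 * (k + 1 + 128 * K - 65 * K) := by
  unfold traj4N; split_ifs <;> omega

/-- Trajectory through binade 2: spacing `8` (grid units). [cell] -/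
theorem traj4N_T2 {K k : ℕ} (h1 : 193 * K ≤ k + 1) (h2 : k + 1 ≤ 321 * K) :
    traj4N K k = 8 * (k + 1 + 128 * K - 193 * K) := by
  unfold traj4N; split_ifs <;> omega

/-- Trajectory through binade 3: spacing `16` (grid units). [cell] -/
theorem traj4N_T3 {K k : ℕ} (h1 : 321 * K ≤ k + 1) (h2 : k + 1 ≤ 449 * K) :
    traj4N K k = 16 * (k + 1 + 128 * K - 321 * K) := by
  unfold traj4N; split_ifs <;> omega

/-- Trajectory through binade 4: spacing `32` (grid units). [cell] -/
theorem traj4N_T4 {K k : ℕ} (h1 : 449 * K ≤ k + 1) (h2 : k + 1 ≤ 577 * K) :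
    traj4N K k = 32 * (k + 1 + 128 * K - 449 * K) := by
  unfold traj4N; split_ifs <;> omega

/-- Trajectory through binade 5: spacing `64` (grid units). [cell] -/
theorem traj4N_T5 {K k : ℕ} (h1 : 577 * K ≤ k + 1) (h2 : k + 1 ≤ 705 * K) :
    traj4N K k = 64 * (k + 1 + 128 * K - 577 * K) := by
  unfold traj4N; split_ifs <;> first | omega | (unfold traj4Nhi; split_ifs; omega)

/-- Trajectory through binade 6: spacing `128` (grid units). [cell] -/
theorem traj4N_T6 {K k : ℕ} (h1 : 705 * K ≤ k + 1) (h2 : k + 1 ≤ 833 * K) :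
    traj4N K k = 128 * (k + 1 + 128 * K - 705 * K) := by
  unfold traj4N; split_ifs <;> first | omega | (unfold traj4Nhi; split_ifs <;> omega)

/-- Trajectory through binade 7: spacing `256` (grid units). [cell] -/
theorem traj4N_T7 {K k : ℕ} (h1 : 833 * K ≤ k + 1) (h2 : k + 1 ≤ 961 * K) :
    traj4N K k = 256 * (k + 1 + 128 * K - 833 * K) := by
  unfold traj4N; split_ifs <;> first | omega | (unfold traj4Nhi; split_ifs <;> omega)

/-- Trajectory through binade 8: spacing `512` (grid units). [cell] -/
theorem traj4N_T8 {K k : ℕ} (h1 : 961 * K ≤ k + 1) (h2 : k + 1 ≤ 1089 * K) :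
    traj4N K k = 512 * (k + 1 + 128 * K - 961 * K) := by
  unfold traj4N; split_ifs <;> first | omega | (unfold traj4Nhi; split_ifs <;> omega)

/-- The final state `v° = (128K+1)·1024` grid units, kept forever. [cell] -/
theorem traj4N_F {K k : ℕ} (h : 1089 * K ≤ k) : traj4N K k = 131072 * K + 1024 := by
  unfold traj4N; split_ifs <;> first | omega | (unfold traj4Nhi; split_ifs <;> omega)

/-- Every state is at most `v° < 2^(m+16) = 8388608K`. [cell] -/
theorem traj4N_le (K k : ℕ) : traj4N K k ≤ 131072 * K + 1024 := by
  unfold traj4N; split_ifs <;> first | omega | (unfold traj4Nhi; split_ifs <;> omega)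

/-- `K ≥ 1`, `2^(m+16) = 8388608K`, `2^(m+1) = 256K`. [folklore] -/
theorem pow_facts4 {K : ℕ} (hM : 2 ^ φ.manBits = 128 * K) :
    1 ≤ K ∧ 2 ^ (φ.manBits + 12 + 4) = 8388608 * K ∧ 2 ^ (φ.manBits + 1) = 256 * K := by
  have h1 : 1 ≤ 2 ^ φ.manBits := Nat.one_le_two_pow
  refine ⟨by omega, ?_, ?_⟩
  · rw [show 2 ^ (φ.manBits + 12 + 4) = 2 ^ φ.manBits * 65536 by ring, hM]; ring
  · rw [pow_succ, hM]; ring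

/-- THE MASS OF THE PREFIX: `(256 + 192 + 64·1040)K + 528`. [cell, gemm.tex Thm. t:thetapmix] -/
theorem sum_fam4Z (K : ℕ) : ∑ k ∈ range (1089 * K + 1), fam4Z K k = 67008 * K + 528 := by
  have eP : ∑ k ∈ range K, fam4Z K k = 256 * (K : ℕ) := by
    rw [sum_congr rfl (fun k hk => fam4Z_P (K := K) (mem_range.mp hk)), sum_const, card_range,
      nsmul_eq_mul]
    ring
  have eB0 : ∑ e ∈ range (64 * K), fam4Z K (K + e) = 3 * (64 * K : ℕ) := by
    rw [sum_congr rfl (fun e he => fam4Z_B0 (K := K) (by omega)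
      (by have := mem_range.mp he; omega)), sum_const, card_range, nsmul_eq_mul]
    push_cast; ring
  have eB : ∀ (T : ℕ) (x h : ℤ), (∀ e, e < 128 * K → fam4Z K (T * K + e) = pairZ x h e) →
      ∑ e ∈ range (2 * (64 * K)), fam4Z K (T * K + e) = (64 * K : ℕ) * (x + h) := by
    intro T x h hB
    rw [sum_congr rfl (fun e he => hB e (by have := mem_range.mp he; omega)), sum_pairZ]
  rw [sum_range_succ, fam4Z_E,
    show 1089 * K = 961 * K + 2 * (64 * K) by ring, sum_range_add,
    eB 961 264 256 (fam4Z_B8 K),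
    show 961 * K = 833 * K + 2 * (64 * K) by ring, sum_range_add,
    eB 833 132 128 (fam4Z_B7 K),
    show 833 * K = 705 * K + 2 * (64 * K) by ring, sum_range_add,
    eB 705 66 64 (fam4Z_B6 K),
    show 705 * K = 577 * K + 2 * (64 * K) by ring, sum_range_add,
    eB 577 33 32 (fam4Z_B5 K),
    show 577 * K = 449 * K + 2 * (64 * K) by ring, sum_range_add,
    eB 449 18 16 (fam4Z_B4 K),
    show 449 * K = 321 * K + 2 * (64 * K) by ring, sum_range_add,
    eB 321 9 8 (fam4Z_B3 K),
    show 321 * K = 193 * K + 2 * (64 * K) by ring, sum_range_add,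
    eB 193 5 4 (fam4Z_B2 K),
    show 193 * K = 65 * K + 2 * (64 * K) by ring, sum_range_add,
    eB 65 3 2 (fam4Z_B1 K),
    show 65 * K = K + 64 * K by ring, sum_range_add, eB0, eP]
  push_cast; ring

/-- EVERY LETTER IS IN THE LAW'S ALPHABET `Λ(E2M3·E2M1)` (grid integers), and the prefix
letters are positive. [cell; `e2m3e2m1Law` of `GemmThetaLawGenMixAData`] -/
theorem fam4Z_mem_pos (K k : ℕ) :
    fam4Z K k ∈ e2m3e2m1Law.lam ∧ (k ≤ 1089 * K → 0 < fam4Z K k) := by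
  rcases (by omega : k < K ∨ (K ≤ k ∧ k < 65 * K) ∨
      (65 * K ≤ k ∧ k < 193 * K) ∨
      (193 * K ≤ k ∧ k < 321 * K) ∨
      (321 * K ≤ k ∧ k < 449 * K) ∨
      (449 * K ≤ k ∧ k < 577 * K) ∨
      (577 * K ≤ k ∧ k < 705 * K) ∨
      (705 * K ≤ k ∧ k < 833 * K) ∨
      (833 * K ≤ k ∧ k < 961 * K) ∨
      (961 * K ≤ k ∧ k < 1089 * K) ∨
      k = 1089 * K ∨ 1089 * K < k) with
      h | h | h | h | h | h | h | h | h | h | h | h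
  · rw [fam4Z_P h]; exact ⟨by decide, fun _ => by decide⟩
  · rw [fam4Z_B0 h.1 h.2]; exact ⟨by decide, fun _ => by decide⟩
  · obtain ⟨e, he, rfl⟩ : ∃ e, e < 128 * K ∧ k = 65 * K + e :=
      ⟨k - 65 * K, by omega, by omega⟩
    rw [fam4Z_B1 K e he]; unfold pairZ
    exact ⟨by split <;> decide, fun _ => by split <;> decide⟩
  · obtain ⟨e, he, rfl⟩ : ∃ e, e < 128 * K ∧ k = 193 * K + e :=
      ⟨k - 193 * K, by omega, by omega⟩
    rw [fam4Z_B2 K e he]; unfold pairZ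
    exact ⟨by split <;> decide, fun _ => by split <;> decide⟩
  · obtain ⟨e, he, rfl⟩ : ∃ e, e < 128 * K ∧ k = 321 * K + e :=
      ⟨k - 321 * K, by omega, by omega⟩
    rw [fam4Z_B3 K e he]; unfold pairZ
    exact ⟨by split <;> decide, fun _ => by split <;> decide⟩
  · obtain ⟨e, he, rfl⟩ : ∃ e, e < 128 * K ∧ k = 449 * K + e :=
      ⟨k - 449 * K, by omega, by omega⟩
    rw [fam4Z_B4 K e he]; unfold pairZ
    exact ⟨by split <;> decide, fun _ => by split <;> decide⟩
  · obtain ⟨e, he, rfl⟩ : ∃ e, e < 128 * K ∧ k = 577 * K + e :=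
      ⟨k - 577 * K, by omega, by omega⟩
    rw [fam4Z_B5 K e he]; unfold pairZ
    exact ⟨by split <;> decide, fun _ => by split <;> decide⟩
  · obtain ⟨e, he, rfl⟩ : ∃ e, e < 128 * K ∧ k = 705 * K + e :=
      ⟨k - 705 * K, by omega, by omega⟩
    rw [fam4Z_B6 K e he]; unfold pairZ
    exact ⟨by split <;> decide, fun _ => by split <;> decide⟩
  · obtain ⟨e, he, rfl⟩ : ∃ e, e < 128 * K ∧ k = 833 * K + e :=
      ⟨k - 833 * K, by omega, by omega⟩
    rw [fam4Z_B7 K e he]; unfold pairZ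
    exact ⟨by split <;> decide, fun _ => by split <;> decide⟩
  · obtain ⟨e, he, rfl⟩ : ∃ e, e < 128 * K ∧ k = 961 * K + e :=
      ⟨k - 961 * K, by omega, by omega⟩
    rw [fam4Z_B8 K e he]; unfold pairZ
    exact ⟨by split <;> decide, fun _ => by split <;> decide⟩
  · rw [h, fam4Z_E]; exact ⟨by decide, fun _ => by decide⟩
  · rw [fam4Z_tail h]; exact ⟨by decide, fun h' => absurd h' (by omega)⟩

/-- EVERY LETTER IS A PRODUCT OF AN E2M3 AND AN E2M1 DATUM: `fam4 K k ∈ Λ/2^4`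
(`16 = 4·4`, `3/16 = 0.375·0.5`, …, `33 = 5.5·6`, `-30 = -7.5·4`).
[cell; `e2m3e2m1Law.PiL 4`; RouhaniEtAl2023MX] -/
theorem fam4_mem (K k : ℕ) : e2m3e2m1Law.PiL 4 (fam4 K k) :=
  ⟨fam4Z K k, (fam4Z_mem_pos K k).1, by unfold fam4; norm_num⟩

end Summit.Ventures.CertifiedArithmetic.LowPrec.Gemm
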